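import Mathlib
import Summits.Ventures.Crystal3D.Theorems.StickyWulffConstantTextureLiminfTentBilayerPrelude
import Summits.Ventures.Crystal3D.Theorems.StickyWulffConstantTextureLiminfTentBarlowBonds
import Summits.Ventures.Crystal3D.Theorems.StickyWulffConstantTextureLiminfTentComplex
import HarnessLib

/-!
# The tent on the close-packed LAYER PLANES (lane T, brick (T0), stmt-Ventures-23912)

HONEST FRAMING. Venture `Summits/Ventures/Crystal3D` (cell `crystal3d-full`), route `route-Ventures-StickyWulffConstant`,
helper `--supports` the law-v5 crux `TextureLiminfV5` (stmt-Ventures-23912), towards the registered stub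
`stub_T0cover : BarlowFreeCertificateCover` (the Barlow tent with ONE COMMON LEVEL and the layer-plane COVER clause,
finding F9).  The cover clause needs two facts about the tent `f_X` (`…TentHatDefs.lean`) on the `(111)` layer
planes `{⟪(1,1,1), √2 x⟫ = 2ℓ}` of the cubic frame, proved here census-free:

* `triangle_subset_closedChamber` — every in-plane CONTACT TRIANGLE (three sites of one layer at mutual distance
  `1`) lies in one closed chamber (base of a down-tetrahedron or of an octahedron corner; a 36-case table reduced to
  the vertex lemmas of `…TentCellKinds.lean`), hence (`tent_triangle_combo`, with `exists_affine_tent`,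
  `convex_closedChamber`, `tent_site`) the tent is the BARYCENTRIC INTERPOLATION of `1_X` on it;
* `exists_triangle_combo_of_inner_eq` — every point of a layer plane is a convex combination of the vertices of
  a contact triangle of that layer (the two triangles of the unit square of `(y₀, y₁) = √2 (x₀, x₁)`);
* `tent_pullback_eq_of_shared_layer` — AGREEMENT: two rigid motions of the cubic bilayer frame whose images
  share a layer (as the bilayers `i`, `i+1` of a Barlow stacking share the layer `i+1`) induce the same function
  on the shared plane from the pulled-back occupancies of one atom set (contacts transfer through distances,
  `mem_fccOffsets_of_norm_site`; convex combinations through `motion_combo`);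
* `exists_mem_closure_piece` — DENSITY: if open pieces exhaust `{f_X > t} ∩ S₀` up to a null set, every point
  of the closed slab with `f_X > t` lies in the closure of one piece (`mem_closure_slab_of_inner_eq`: the layer
  planes bound the slab).
WHAT THIS IS NOT: the certificate or its assembly (`…TextureBuildTentCoverLevel/Holds.lean`); F-C1 not moved.
-/

noncomputable section

namespace Summit.Ventures.Crystal3D.TentCertificate

open Finset Summit.Ventures.Crystal3D MeasureTheory
open Literature.Geometry.DiscreteGeometry (intVec intVec_apply)
open Summit.Ventures.Crystal3D.Cruxes.TextureLiminf.TexShadow (polytope)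
open scoped RealInnerProductSpace ENNReal

/-! ## Closed chambers are convex -/

/-- A closed chamber is convex (fourteen closed half-spaces). -/
theorem convex_closedChamber (k : Fin 3 → ℤ) (m : Fin 4 → ℤ) : Convex ℝ (closedChamber k m) := by
  intro x hx y hy a b ha hb hab
  obtain ⟨hx1, hx2⟩ := hx
  obtain ⟨hy1, hy2⟩ := hy
  have hsplit : ∀ r : ℝ, r = a * r + b * r := fun r => by rw [← add_mul, hab, one_mul]
  refine ⟨fun i => ?_, fun j => ?_⟩
  · have e : Real.sqrt 2 * (a • x + b • y) i = a * (Real.sqrt 2 * x i) + b * (Real.sqrt 2 * y i) := by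
      simp only [PiLp.add_apply, PiLp.smul_apply, smul_eq_mul]; ring
    rw [e]
    constructor <;> linarith [mul_le_mul_of_nonneg_left (hx1 i).1 ha, mul_le_mul_of_nonneg_left (hy1 i).1 hb,
      mul_le_mul_of_nonneg_left (hx1 i).2 ha, mul_le_mul_of_nonneg_left (hy1 i).2 hb, hsplit (k i : ℝ)]
  · have e : ⟪intVec (normal4 j), Real.sqrt 2 • (a • x + b • y)⟫ =
        a * ⟪intVec (normal4 j), Real.sqrt 2 • x⟫ + b * ⟪intVec (normal4 j), Real.sqrt 2 • y⟫ := by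
      simp only [smul_add, smul_smul, inner_add_right, real_inner_smul_right]; ring
    rw [e]
    constructor <;> linarith [mul_le_mul_of_nonneg_left (hx2 j).1 ha, mul_le_mul_of_nonneg_left (hy2 j).1 hb,
      mul_le_mul_of_nonneg_left (hx2 j).2 ha, mul_le_mul_of_nonneg_left (hy2 j).2 hb, hsplit (m j : ℝ)]

/-! ## The in-plane contact triangles lie in one closed chamber -/

/-- The six IN-PLANE nearest-neighbour offsets (`lay = 0`). -/
theorem inPlane_offset_cases {d : Site} (hd : d ∈ fccOffsets) (hl : lay d = 0) :
    d = ![1, -1, 0] ∨ d = ![-1, 1, 0] ∨ d = ![1, 0, -1] ∨ d = ![-1, 0, 1] ∨ d = ![0, 1, -1] ∨ d = ![0, -1, 1] := by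
  simp only [fccOffsets, Finset.mem_insert, Finset.mem_singleton] at hd
  rcases hd with rfl | rfl | rfl | rfl | rfl | rfl | rfl | rfl | rfl | rfl | rfl | rfl <;>
    first | exact absurd hl (by decide) | decide

/-- TABLE: two in-plane nearest-neighbour offsets `u, v` at mutual contact are, seen from the common vertex, two
edges of a down-tetrahedron base `{p' - e₀, p' - e₁, p' - e₂}` or of an octahedron base `{p, p + octV 3, p + octV 5}`. -/
theorem inPlane_contact_pair_table {u v : Site} (hu : u ∈ fccOffsets) (hv : v ∈ fccOffsets) (hlu : lay u = 0)
    (hlv : lay v = 0) (hvu : v - u ∈ fccOffsets) :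
    ∃ i j k : Fin 3,
      (u = tetDnV j.succ - tetDnV i.succ ∧ v = tetDnV k.succ - tetDnV i.succ) ∨
      (u = octV (octIdx j false) - octV (octIdx i false) ∧ v = octV (octIdx k false) - octV (octIdx i false)) := by
  rcases inPlane_offset_cases hu hlu with rfl | rfl | rfl | rfl | rfl | rfl <;>
    rcases inPlane_offset_cases hv hlv with rfl | rfl | rfl | rfl | rfl | rfl <;>
    first | exact absurd hvu (by decide) | decide

/-- **Every in-plane contact triangle `{a, b, c}` (three sites of one layer at mutual distance `1`) lies in ONE
closed chamber** (the base of a down-tetrahedron or of an octahedron corner). -/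
theorem triangle_subset_closedChamber {a b c : Site} (hab : b - a ∈ fccOffsets) (hac : c - a ∈ fccOffsets)
    (hbc : c - b ∈ fccOffsets) (hlb : lay b = lay a) (hlc : lay c = lay a) :
    ∃ (k : Fin 3 → ℤ) (m : Fin 4 → ℤ),
      site a ∈ closedChamber k m ∧ site b ∈ closedChamber k m ∧ site c ∈ closedChamber k m := by
  have hlu : lay (b - a) = 0 := by
    have h := lay_add (b - a) a; rw [sub_add_cancel] at h; omega
  have hlv : lay (c - a) = 0 := by
    have h := lay_add (c - a) a; rw [sub_add_cancel] at h; omega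
  have hvu : (c - a) - (b - a) ∈ fccOffsets := by rwa [sub_sub_sub_cancel_right]
  obtain ⟨i, j, k, h⟩ := inPlane_contact_pair_table hab hac hlu hlv hvu
  rcases h with ⟨hu, hv⟩ | ⟨hu, hv⟩
  · obtain ⟨p', rfl⟩ : ∃ p', a = p' + tetDnV i.succ := ⟨a - tetDnV i.succ, by abel⟩
    have eb : b = p' + tetDnV j.succ := by
      calc b = (b - (p' + tetDnV i.succ)) + (p' + tetDnV i.succ) := by abel
        _ = _ := by rw [hu]; abel
    have ec : c = p' + tetDnV k.succ := by
      calc c = (c - (p' + tetDnV i.succ)) + (p' + tetDnV i.succ) := by abel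
        _ = _ := by rw [hv]; abel
    rw [eb, ec]
    exact ⟨_, _, site_tetDnV_mem_closedChamber _ _, site_tetDnV_mem_closedChamber _ _,
      site_tetDnV_mem_closedChamber _ _⟩
  · obtain ⟨p', rfl⟩ : ∃ p', a = p' + octV (octIdx i false) := ⟨a - octV (octIdx i false), by abel⟩
    have eb : b = p' + octV (octIdx j false) := by
      calc b = (b - (p' + octV (octIdx i false))) + (p' + octV (octIdx i false)) := by abel
        _ = _ := by rw [hu]; abel
    have ec : c = p' + octV (octIdx k false) := by
      calc c = (c - (p' + octV (octIdx i false))) + (p' + octV (octIdx i false)) := by abel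
        _ = _ := by rw [hv]; abel
    rw [eb, ec]
    exact ⟨_, _, site_octV_mem_closedChamber p' (fun _ => false) i, site_octV_mem_closedChamber p' (fun _ => false) j,
      site_octV_mem_closedChamber p' (fun _ => false) k⟩

/-! ## The tent on an in-plane contact triangle is the barycentric interpolation of the occupancy -/

/-- **Barycentric values**: on an in-plane contact triangle the tent is the barycentric interpolation of `1_X`. -/
theorem tent_triangle_combo (X : Finset Site) {a b c : Site} (hab : b - a ∈ fccOffsets)
    (hac : c - a ∈ fccOffsets) (hbc : c - b ∈ fccOffsets) (hlb : lay b = lay a) (hlc : lay c = lay a)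
    {t₀ t₁ t₂ : ℝ} (h₀ : 0 ≤ t₀) (h₁ : 0 ≤ t₁) (h₂ : 0 ≤ t₂) (hsum : t₀ + t₁ + t₂ = 1) :
    tent X (t₀ • site a + t₁ • site b + t₂ • site c) =
      t₀ * (if a ∈ X then 1 else 0) + t₁ * (if b ∈ X then 1 else 0) + t₂ * (if c ∈ X then 1 else 0) := by
  classical
  obtain ⟨k, m, ha, hb, hc⟩ := triangle_subset_closedChamber hab hac hbc hlb hlc
  obtain ⟨g, β, hg⟩ := exists_affine_tent X k m
  have hconv := convex_closedChamber k m
  have hmem : t₀ • site a + t₁ • site b + t₂ • site c ∈ closedChamber k m := by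
    by_cases h2 : t₂ = 1
    · have h0 : t₀ = 0 := by linarith
      have h1 : t₁ = 0 := by linarith
      rw [h0, h1, h2, zero_smul, zero_smul, one_smul, zero_add, zero_add]; exact hc
    · have hlt : t₂ < 1 := lt_of_le_of_ne (by linarith) h2
      have hpos : 0 < t₀ + t₁ := by linarith
      have hab' : (t₀ / (t₀ + t₁)) • site a + (t₁ / (t₀ + t₁)) • site b ∈ closedChamber k m :=
        hconv ha hb (div_nonneg h₀ hpos.le) (div_nonneg h₁ hpos.le) (by field_simp)
      have h := hconv hab' hc hpos.le h₂ (by linarith)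
      have e : (t₀ + t₁) • ((t₀ / (t₀ + t₁)) • site a + (t₁ / (t₀ + t₁)) • site b) + t₂ • site c =
          t₀ • site a + t₁ • site b + t₂ • site c := by
        rw [smul_add, smul_smul, smul_smul, mul_div_cancel₀ _ hpos.ne', mul_div_cancel₀ _ hpos.ne']
      rw [e] at h; exact h
  rw [hg _ hmem]
  have hva : ⟪g, site a⟫ + β = if a ∈ X then 1 else 0 := by rw [← hg _ ha, site_eq, tent_site]
  have hvb : ⟪g, site b⟫ + β = if b ∈ X then 1 else 0 := by rw [← hg _ hb, site_eq, tent_site]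
  have hvc : ⟪g, site c⟫ + β = if c ∈ X then 1 else 0 := by rw [← hg _ hc, site_eq, tent_site]
  rw [← hva, ← hvb, ← hvc]
  simp only [inner_add_right, inner_smul_right]
  have : β = (t₀ + t₁ + t₂) * β := by rw [hsum, one_mul]
  linear_combination this

/-! ## Contact offsets from unit distances -/

/-- **Unit distance between sites means contact**: `‖site d‖ = 1` forces `d ∈ fccOffsets`. -/
theorem mem_fccOffsets_of_norm_site {d : Site} (h : ‖site d‖ = 1) : d ∈ fccOffsets := by
  have hs : (0 : ℝ) < Real.sqrt 2 := by positivity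
  have h1 : Real.sqrt (Literature.Geometry.DiscreteGeometry.sqNormInt (fccPoint d) : ℝ) = Real.sqrt 2 := by
    rw [site_eq, norm_smul, norm_inv, Real.norm_of_nonneg hs.le, Literature.Geometry.DiscreteGeometry.norm_intVec]
      at h
    field_simp at h
    linarith
  have h2 : (Literature.Geometry.DiscreteGeometry.sqNormInt (fccPoint d) : ℝ) = 2 := by
    have h0 : (0 : ℝ) ≤ (Literature.Geometry.DiscreteGeometry.sqNormInt (fccPoint d) : ℝ) := by
      unfold Literature.Geometry.DiscreteGeometry.sqNormInt; positivity
    have h1' := congrArg (fun r => r ^ 2) h1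
    simp only [Real.sq_sqrt h0, Real.sq_sqrt (by norm_num : (0:ℝ) ≤ 2)] at h1'
    exact h1'
  have h3 : Literature.Geometry.DiscreteGeometry.sqNormInt (fccPoint d) = 2 := by exact_mod_cast h2
  simp only [Literature.Geometry.DiscreteGeometry.sqNormInt, fccPoint, Matrix.cons_val_zero, Matrix.cons_val_one,
    Matrix.cons_val] at h3
  have sq01 := sq_nonneg (d 0 + d 1); have sq02 := sq_nonneg (d 0 + d 2); have sq12 := sq_nonneg (d 1 + d 2)
  have hb0 : -1 ≤ d 0 + d 1 ∧ d 0 + d 1 ≤ 1 := by constructor <;> nlinarith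
  have hb1 : -1 ≤ d 0 + d 2 ∧ d 0 + d 2 ≤ 1 := by constructor <;> nlinarith
  have hb2 : -1 ≤ d 1 + d 2 ∧ d 1 + d 2 ≤ 1 := by constructor <;> nlinarith
  have hd : d = ![d 0, d 1, d 2] := by ext i; fin_cases i <;> rfl
  rw [hd]
  generalize d 0 = x at *
  generalize d 1 = y at *
  generalize d 2 = w at *
  obtain ⟨hx1, hx2⟩ : -1 ≤ x ∧ x ≤ 1 := by omega
  obtain ⟨hy1, hy2⟩ : -1 ≤ y ∧ y ≤ 1 := by omega
  obtain ⟨hw1, hw2⟩ : -1 ≤ w ∧ w ≤ 1 := by omega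
  interval_cases x <;> interval_cases y <;> interval_cases w <;> first | decide | (exfalso; omega)

/-- Sites at distance `1` are in contact. -/
theorem sub_mem_fccOffsets_of_dist_site {a b : Site} (h : dist (site a) (site b) = 1) : a - b ∈ fccOffsets :=
  mem_fccOffsets_of_norm_site (by rw [site_sub, ← dist_eq_norm, h])

/-- Sites in contact are at distance `1`. -/
theorem dist_site_of_sub_mem_fccOffsets {a b : Site} (h : a - b ∈ fccOffsets) : dist (site a) (site b) = 1 := by
  rw [dist_eq_norm, ← site_sub]; exact norm_site_of_mem_fccOffsets h

/-! ## Every point of a layer plane lies in a contact triangle of that layer -/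

/-- **Layer planes are tiled by contact triangles**: a point of the cubic layer plane `ℓ`
(`⟪(1,1,1), √2 z⟫ = 2ℓ`) is a convex combination of three layer-`ℓ` sites at mutual contact. -/
theorem exists_triangle_combo_of_inner_eq {ℓ : ℤ} {z : EuclideanSpace ℝ (Fin 3)}
    (hz : ⟪intVec (normal4 0), Real.sqrt 2 • z⟫ = 2 * ℓ) :
    ∃ a b c : Site, lay a = ℓ ∧ lay b = ℓ ∧ lay c = ℓ ∧
      b - a ∈ fccOffsets ∧ c - a ∈ fccOffsets ∧ c - b ∈ fccOffsets ∧
      ∃ t₀ t₁ t₂ : ℝ, 0 ≤ t₀ ∧ 0 ≤ t₁ ∧ 0 ≤ t₂ ∧ t₀ + t₁ + t₂ = 1 ∧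
        z = t₀ • site a + t₁ • site b + t₂ • site c := by
  have hs : (0 : ℝ) < Real.sqrt 2 := by positivity
  rw [inner_intVec_left] at hz
  simp only [normal4, PiLp.smul_apply, smul_eq_mul, Matrix.cons_val_zero, Matrix.cons_val_one, Matrix.cons_val,
    Int.cast_one, one_mul] at hz
  set i : ℤ := ⌊Real.sqrt 2 * z 0⌋ with hi
  set j : ℤ := ⌊Real.sqrt 2 * z 1⌋ with hj
  set α : ℝ := Real.sqrt 2 * z 0 - i with hα
  set β : ℝ := Real.sqrt 2 * z 1 - j with hβ
  have hα0 : 0 ≤ α := by rw [hα]; linarith [Int.floor_le (Real.sqrt 2 * z 0)]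
  have hα1 : α < 1 := by rw [hα]; linarith [Int.lt_floor_add_one (Real.sqrt 2 * z 0)]
  have hβ0 : 0 ≤ β := by rw [hβ]; linarith [Int.floor_le (Real.sqrt 2 * z 1)]
  have hβ1 : β < 1 := by rw [hβ]; linarith [Int.lt_floor_add_one (Real.sqrt 2 * z 1)]
  have hz0 : z 0 = (Real.sqrt 2)⁻¹ * (i + α) := by rw [hα]; field_simp; ring
  have hz1 : z 1 = (Real.sqrt 2)⁻¹ * (j + β) := by rw [hβ]; field_simp; ring
  have hz2 : z 2 = (Real.sqrt 2)⁻¹ * (2 * ℓ - i - j - α - β) := by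
    rw [hα, hβ]; field_simp; linarith
  by_cases hαβ : α + β ≤ 1
  · refine ⟨![i + j - ℓ, ℓ - j, ℓ - i], ![i + j - ℓ, ℓ - j, ℓ - i] + ![1, 0, -1],
      ![i + j - ℓ, ℓ - j, ℓ - i] + ![1, -1, 0], ?_, ?_, ?_, ?_, ?_, ?_,
      1 - α - β, α, β, by linarith, hα0, hβ0, by ring, ?_⟩
    · simp only [lay, Matrix.cons_val_zero, Matrix.cons_val_one, Matrix.cons_val]; ring
    · simp only [lay, Pi.add_apply, Matrix.cons_val_zero, Matrix.cons_val_one, Matrix.cons_val]; ring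
    · simp only [lay, Pi.add_apply, Matrix.cons_val_zero, Matrix.cons_val_one, Matrix.cons_val]; ring
    · rw [add_sub_cancel_left]; decide
    · rw [add_sub_cancel_left]; decide
    · rw [add_sub_add_left_eq_sub]; decide
    · ext l
      fin_cases l <;>
        simp [site_apply, fccPoint, hz0, hz1, hz2] <;> ring
  · push Not at hαβ
    refine ⟨![i + j + 2 - ℓ, ℓ - j - 1, ℓ - i - 1], ![i + j + 2 - ℓ, ℓ - j - 1, ℓ - i - 1] + ![-1, 0, 1],
      ![i + j + 2 - ℓ, ℓ - j - 1, ℓ - i - 1] + ![-1, 1, 0], ?_, ?_, ?_, ?_, ?_, ?_,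
      α + β - 1, 1 - α, 1 - β, by linarith, by linarith, by linarith, by ring, ?_⟩
    · simp only [lay, Matrix.cons_val_zero, Matrix.cons_val_one, Matrix.cons_val]; ring
    · simp only [lay, Pi.add_apply, Matrix.cons_val_zero, Matrix.cons_val_one, Matrix.cons_val]; ring
    · simp only [lay, Pi.add_apply, Matrix.cons_val_zero, Matrix.cons_val_one, Matrix.cons_val]; ring
    · rw [add_sub_cancel_left]; decide
    · rw [add_sub_cancel_left]; decide
    · rw [add_sub_add_left_eq_sub]; decide
    · ext l
      fin_cases l <;>
        simp [site_apply, fccPoint, hz0, hz1, hz2] <;> ring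

/-! ## Rigid motions and convex combinations -/

/-- A rigid motion preserves convex (affine) combinations of three points. -/
theorem motion_combo (T : EuclideanSpace ℝ (Fin 3) ≃ₗᵢ[ℝ] EuclideanSpace ℝ (Fin 3))
    (c x y w : EuclideanSpace ℝ (Fin 3)) {t₀ t₁ t₂ : ℝ} (h : t₀ + t₁ + t₂ = 1) :
    T (t₀ • x + t₁ • y + t₂ • w) + c = t₀ • (T x + c) + t₁ • (T y + c) + t₂ • (T w + c) := by
  have hc : c = t₀ • c + t₁ • c + t₂ • c := by rw [← add_smul, ← add_smul, h, one_smul]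
  simp only [map_add, LinearIsometryEquiv.map_smul, smul_add]
  conv_lhs => rw [hc]
  abel

/-! ## The tent has no hats when nothing is occupied -/

/-- The tent of the empty occupancy vanishes. -/
theorem tent_empty (x : EuclideanSpace ℝ (Fin 3)) : tent ∅ x = 0 := by
  simp [tent, idx]

/-! ## Two bilayer motions sharing a layer induce the same tent on the shared layer plane -/

/-- **Agreement across a shared layer.**  Two rigid motions `x ↦ T x + c`, `x ↦ T' x + c'` of the cubic bilayer
frame such that the `T'`-image of the cubic layer `ℓ'` lies in a set `S` every point of which is the `T`-image of
a cubic layer-`ℓ` site (`ℓ, ℓ' ∈ {0,1}`) induce the SAME function on the shared plane: the tents of the two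
pulled-back occupancies of one atom set `X` agree there (both are the barycentric interpolation of `1_X` on the
contact triangles of the shared layer). -/
theorem tent_pullback_eq_of_shared_layer {T T' : EuclideanSpace ℝ (Fin 3) ≃ₗᵢ[ℝ] EuclideanSpace ℝ (Fin 3)}
    {c c' : EuclideanSpace ℝ (Fin 3)} {ℓ ℓ' : ℤ} (hℓ : ℓ = 0 ∨ ℓ = 1) (hℓ' : ℓ' = 0 ∨ ℓ' = 1)
    (X : Finset (EuclideanSpace ℝ (Fin 3))) (S : Set (EuclideanSpace ℝ (Fin 3)))
    (hS : ∀ y ∈ S, ∃ a : Site, lay a = ℓ ∧ T (site a) + c = y)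
    (hS' : ∀ a' : Site, lay a' = ℓ' → T' (site a') + c' ∈ S)
    {y : EuclideanSpace ℝ (Fin 3)} (hy : ⟪intVec (normal4 0), Real.sqrt 2 • T'.symm (y - c')⟫ = 2 * ℓ') :
    tent (pullback T c X) (T.symm (y - c)) = tent (pullback T' c' X) (T'.symm (y - c')) := by
  classical
  obtain ⟨a, b, d, hla, hlb, hld, hab, had, hbd, t₀, t₁, t₂, h₀, h₁, h₂, hsum, hz⟩ :=
    exists_triangle_combo_of_inner_eq hy
  obtain ⟨a₁, hla₁, ha₁⟩ := hS _ (hS' a hla)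
  obtain ⟨b₁, hlb₁, hb₁⟩ := hS _ (hS' b hlb)
  obtain ⟨d₁, hld₁, hd₁⟩ := hS _ (hS' d hld)
  -- contacts transfer through distances
  have hdist : ∀ {p q p₁ q₁ : Site}, T (site p₁) + c = T' (site p) + c' → T (site q₁) + c = T' (site q) + c' →
      q - p ∈ fccOffsets → q₁ - p₁ ∈ fccOffsets := by
    intro p q p₁ q₁ hp hq hpq
    apply sub_mem_fccOffsets_of_dist_site
    have e : dist (site q₁) (site p₁) = dist (T (site q₁) + c) (T (site p₁) + c) := by
      rw [dist_add_right, LinearIsometryEquiv.dist_map]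
    rw [e, hp, hq, dist_add_right, LinearIsometryEquiv.dist_map]
    exact dist_site_of_sub_mem_fccOffsets hpq
  have hab₁ : b₁ - a₁ ∈ fccOffsets := hdist ha₁ hb₁ hab
  have had₁ : d₁ - a₁ ∈ fccOffsets := hdist ha₁ hd₁ had
  have hbd₁ : d₁ - b₁ ∈ fccOffsets := hdist hb₁ hd₁ hbd
  -- the pulled-back point on the `T` side is the same convex combination of the corresponding sites
  have hyT : T.symm (y - c) = t₀ • site a₁ + t₁ • site b₁ + t₂ • site d₁ := by
    apply T.injective
    rw [LinearIsometryEquiv.apply_symm_apply]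
    have h1 : T (t₀ • site a₁ + t₁ • site b₁ + t₂ • site d₁) + c = y := by
      rw [motion_combo T c _ _ _ hsum, ha₁, hb₁, hd₁, ← motion_combo T' c' _ _ _ hsum, ← hz,
        LinearIsometryEquiv.apply_symm_apply, sub_add_cancel]
    rw [← h1, add_sub_cancel_right]
  rw [hz, hyT, tent_triangle_combo _ hab₁ had₁ hbd₁ (by rw [hlb₁, hla₁]) (by rw [hld₁, hla₁]) h₀ h₁ h₂ hsum,
    tent_triangle_combo _ hab had hbd (by rw [hlb, hla]) (by rw [hld, hla]) h₀ h₁ h₂ hsum]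
  have hl : ∀ {p : Site}, lay p = ℓ → (lay p = 0 ∨ lay p = 1) := by
    intro p hp; rw [hp]; exact hℓ
  have hl' : ∀ {p : Site}, lay p = ℓ' → (lay p = 0 ∨ lay p = 1) := by
    intro p hp; rw [hp]; exact hℓ'
  have key : ∀ {p p₁ : Site}, lay p = ℓ' → lay p₁ = ℓ → T (site p₁) + c = T' (site p) + c' →
      (p₁ ∈ pullback T c X ↔ p ∈ pullback T' c' X) := by
    intro p p₁ hp hp₁ he
    rw [mem_pullback, mem_pullback, he]
    exact ⟨fun h => ⟨hl' hp, h.2⟩, fun h => ⟨hl hp₁, h.2⟩⟩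
  simp only [key hla hla₁ ha₁, key hlb hlb₁ hb₁, key hld hld₁ hd₁]

/-! ## Density: a boundary point above the level lies in the closure of a piece -/

/-- The closure of the open slab `S₀ = {0 < ⟪(1,1,1), √2 x⟫ < 2}` contains its two boundary planes. -/
theorem mem_closure_slab_of_inner_eq {z : EuclideanSpace ℝ (Fin 3)} {ℓ : ℤ} (hℓ : ℓ = 0 ∨ ℓ = 1)
    (hz : ⟪intVec (normal4 0), Real.sqrt 2 • z⟫ = 2 * ℓ) :
    z ∈ closure {x : EuclideanSpace ℝ (Fin 3) | 0 < ⟪intVec (normal4 0), Real.sqrt 2 • x⟫ ∧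
      ⟪intVec (normal4 0), Real.sqrt 2 • x⟫ < 2} := by
  have hs : (0 : ℝ) < Real.sqrt 2 := by positivity
  -- a probe vector `w` with `⟪(1,1,1), √2 w⟫ = 1`
  set w : EuclideanSpace ℝ (Fin 3) := (Real.sqrt 2)⁻¹ • EuclideanSpace.single 0 1 with hw
  have hwn : ⟪intVec (normal4 0), Real.sqrt 2 • w⟫ = 1 := by
    rw [hw, smul_smul, mul_inv_cancel₀ hs.ne', one_smul, inner_intVec_left]
    simp [normal4]
  have hlin : ∀ (x : EuclideanSpace ℝ (Fin 3)) (τ : ℝ),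
      ⟪intVec (normal4 0), Real.sqrt 2 • (x + τ • w)⟫ = ⟪intVec (normal4 0), Real.sqrt 2 • x⟫ + τ := by
    intro x τ
    rw [smul_add, inner_add_right, smul_comm (Real.sqrt 2) τ w,
      real_inner_smul_right (intVec (normal4 0)) (Real.sqrt 2 • w) τ, hwn, mul_one]
  -- the sign of the probe: `+w` from the lower plane, `-w` from the upper plane
  set ε : ℝ := if ℓ = 0 then 1 else -1 with hε
  have hseq : Filter.Tendsto (fun n : ℕ => z + ((ε / ((n : ℝ) + 2))) • w) Filter.atTop (nhds z) := by
    have h0 : Filter.Tendsto (fun n : ℕ => ε / ((n : ℝ) + 2)) Filter.atTop (nhds 0) := by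
      have h1 : Filter.Tendsto (fun n : ℕ => ((n : ℝ) + 2)) Filter.atTop Filter.atTop :=
        Filter.tendsto_atTop_add_const_right _ _ tendsto_natCast_atTop_atTop
      exact h1.const_div_atTop ε
    have := (h0.smul_const w).const_add z
    simpa using this
  refine mem_closure_of_tendsto hseq (Filter.Eventually.of_forall fun n => ?_)
  have hn : (0 : ℝ) < (n : ℝ) + 2 := by positivity
  simp only [Set.mem_setOf_eq, hlin, hz]
  rcases hℓ with rfl | rfl
  · simp only [hε, if_true, Int.cast_zero, mul_zero, zero_add]
    exact ⟨by positivity, by rw [div_lt_iff₀ hn]; linarith⟩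
  · simp only [hε, one_ne_zero, if_false, Int.cast_one, mul_one]
    have h1 : (-1 : ℝ) / ((n : ℝ) + 2) > -2 := by rw [gt_iff_lt, lt_div_iff₀ hn]; linarith
    have h2 : (-1 : ℝ) / ((n : ℝ) + 2) < 0 := by rw [div_lt_iff₀ hn]; linarith
    constructor <;> linarith

/-- **Density.**  If the pieces exhaust `{f_X > t} ∩ S₀` up to a null set, every point of the closed slab
with `f_X > t` lies in the closure of one of the pieces. -/
theorem exists_mem_closure_piece {X : Finset Site} {t : ℝ} {J : ℕ}
    {Hd : Fin J → Finset (EuclideanSpace ℝ (Fin 3) × ℝ)}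
    (hexh : volume (({x | t < tent X x} ∩ {x : EuclideanSpace ℝ (Fin 3) |
        0 < ⟪intVec (normal4 0), Real.sqrt 2 • x⟫ ∧ ⟪intVec (normal4 0), Real.sqrt 2 • x⟫ < 2}) \
      ⋃ j, polytope (Hd j)) = 0)
    {z : EuclideanSpace ℝ (Fin 3)}
    (hz : z ∈ closure {x : EuclideanSpace ℝ (Fin 3) | 0 < ⟪intVec (normal4 0), Real.sqrt 2 • x⟫ ∧
      ⟪intVec (normal4 0), Real.sqrt 2 • x⟫ < 2})
    (htz : t < tent X z) : ∃ j, z ∈ closure (polytope (Hd j)) := by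
  set S₀ := {x : EuclideanSpace ℝ (Fin 3) | 0 < ⟪intVec (normal4 0), Real.sqrt 2 • x⟫ ∧
      ⟪intVec (normal4 0), Real.sqrt 2 • x⟫ < 2} with hS₀
  set W := {x | t < tent X x} ∩ S₀ with hW
  have hopen_t : IsOpen {x : EuclideanSpace ℝ (Fin 3) | t < tent X x} := isOpen_lt continuous_const (continuous_tent X)
  have hcn : Continuous fun x : EuclideanSpace ℝ (Fin 3) => ⟪intVec (normal4 0), Real.sqrt 2 • x⟫ :=
    continuous_const.inner (continuous_const_smul (Real.sqrt 2))
  have hopen_S : IsOpen S₀ := (isOpen_lt continuous_const hcn).inter (isOpen_lt hcn continuous_const)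
  have hWo : IsOpen W := hopen_t.inter hopen_S
  -- `z ∈ closure W`
  have hzW : z ∈ closure W := hopen_t.inter_closure ⟨htz, hz⟩
  -- `W ⊆ closure (⋃ pieces)`: an open set minus a null set is dense in it
  have hWcl : W ⊆ closure (⋃ j, polytope (Hd j)) := by
    intro w hw
    rw [mem_closure_iff_nhds]
    intro V hV
    by_contra hne
    rw [Set.not_nonempty_iff_eq_empty] at hne
    obtain ⟨V', hV'V, hV'o, hwV'⟩ := mem_nhds_iff.1 hV
    have hpos : 0 < volume (V' ∩ W) := (hV'o.inter hWo).measure_pos volume ⟨w, hwV', hw⟩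
    have hsub : V' ∩ W ⊆ W \ ⋃ j, polytope (Hd j) := by
      rintro x ⟨hxV', hxW⟩
      refine ⟨hxW, fun hxU => ?_⟩
      have : x ∈ V ∩ ⋃ j, polytope (Hd j) := ⟨hV'V hxV', hxU⟩
      rw [hne] at this; exact this
    have := measure_mono_null hsub hexh
    exact hpos.ne' this
  have hz' : z ∈ closure (⋃ j, polytope (Hd j)) := by
    have := closure_mono hWcl hzW
    rwa [closure_closure] at this
  rw [closure_iUnion_of_finite] at hz'
  exact Set.mem_iUnion.1 hz'

end Summit.Ventures.Crystal3D.TentCertificate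

end
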